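import Summits.Ventures.HSemireg.WedgeHankelOuterPieces

/-!
# Venture HSemireg — THE COUNT OF EVERY PAIR TYPE AND THE COMPLETE TABLE OF PIECES: a pair type is `𝟙_{A₁} + 2·𝟙_{A₂}` (`A₁`, `A₂` disjoint sets of pairs: one letter from
# each pair of `A₁`, both letters from each pair of `A₂`), it has `2^{|A₁|}` supports, and on that piece (degree `k = |A₁| + 2|A₂|`) th-7's kernel has dimension `2^{|A₁|}`
# (`A₂ ≠ ∅`: all kernel) or `2^{|A₁|} − rank H_k(q)` (`A₂ = ∅`), the image piece of type `+𝟙` has dimension `0` or `rank H_k(q)` — every field, uniform in `n`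

HONEST FRAMING. Part of the Lean index of the computation cell `pub-hsemireg` (seat p10 gen 23, Sunday typer «UNIFORM-IN-n»).
Finite-dimensional EXTERIOR ALGEBRA over a field ONLY: no variety, no cohomology theory, no sheaf, no Ext group, no semiregularity map;
nothing here says that HC / HC_CM / HC_AV holds; no Literature fact is declared or used.  Custodian versions as in `WedgeHankelSiegelIdeal` (1/3); the dictionary (pair type =
multidegree of a form in the `n` factors of the box) is QUOTED, never asserted.

WHAT IS IN THE TREE.  H10 `ptype`, `ptype_union`; L1 (this seat) `letters_eq_image_union_image`, `card_letters_eq`; L2 `ptype_image_xJ`, `ptype_image_yJ`, `disjoint_image_xJ_image_yJ`,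
`card_filter_ptype_eq_indicator` (`2^{|A|}` pure supports), `mem_pairs_of_ptype_eq_indicator`, `finrank_Kr_w_inf_Sp_pure_add`; L4 `pair_subset_of_two_le_ptype`,
`ptype_eq_two_of_pair_subset`, `Kr_inf_Sp_ptype_eq_Hom_inf_of_two_le`, `finrank_V_inf_Sp_ptype_succ_eq_zero_of_two_le`, `finrank_V_w_inf_Sp_pure_succ`.
THIS FILE (namespace `Summit.Ventures.HSemireg.Wedge.HankelOuter` continued; imports L4):
* §380 EVERY PAIR TYPE IS `𝟙_{A₁} + 2·𝟙_{A₂}`: `ptype_le_two`, `ptype_eq_one_two` (`ptype s = [· ∈ A₁(s)] + 2[· ∈ A₂(s)]` with `A₁(s) = {ptype = 1}`, `A₂(s) = {ptype = 2}`,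
  disjoint).
* §381 THE COUNT: `ptype_letters` (the letters of `A₂` have type `2·𝟙_{A₂}`), `letters_subset_of_ptype_eq_one_two`, `ptype_sdiff_letters_eq_indicator`,
  **`card_filter_ptype_eq_one_two`: `#{s : ptype s = 𝟙_{A₁} + 2·𝟙_{A₂}} = 2^{|A₁|}`** (`A₁ ∩ A₂ = ∅`; `s ↦ s ∖ letters(A₂)` is a bijection onto the pure supports on `A₁`),
  `finrank_Sp_ptype_one_two`, `card_eq_of_ptype_eq_one_two` (`|s| = |A₁| + 2|A₂|`), `Hom_inf_Sp_ptype_one_two` (the piece lives in degree `|A₁| + 2|A₂|`).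
* §382 THE COMPLETE TABLE for th-7's class `w_N(q)`, `k = |A₁| + 2|A₂|`: **`finrank_Kr_w_inf_Sp_ptype_one_two_of_nonempty`** (`A₂ ≠ ∅`: kernel piece `= 2^{|A₁|}`, all of it),
  **`finrank_V_w_inf_Sp_ptype_one_two_succ_of_nonempty`** (image piece `0`), and the uniform statements **`finrank_Kr_w_inf_Sp_ptype_one_two_add`**:
  `dim (Kr ⊓ Sp(ptype = τ)) + [A₂ = ∅] · rank H_k(q) = 2^{|A₁|}` and **`finrank_V_w_inf_Sp_ptype_one_two_succ`**: `dim (V ⊓ Sp(ptype = τ + 𝟙)) = [A₂ = ∅] · rank H_k(q)`.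
READING: together with H10/I7 (kernel and image are the direct sums of their pair-type pieces) this is the value of EVERY piece: the Hankel rank `r_k(q)` is seen once by every
`k`-set of pairs, through its multilinear piece, and by nothing else.  Nothing Ext-side.  New names only.
-/

open Module

namespace Summit.Ventures.HSemireg.Wedge.HankelOuter

open Summit.Ventures.HSemireg.Wedge Summit.Ventures.HSemireg.Wedge.Kunneth Summit.Ventures.HSemireg.Wedge.Hankel
  Summit.Ventures.HSemireg.Wedge.BasisFree Summit.Ventures.HSemireg.Wedge.HankelSiegel Summit.Ventures.HSemireg.Wedge.HankelSiegelIdeal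
  Summit.Ventures.HSemireg.Wedge.KunnethKernel Summit.Ventures.HSemireg.Wedge.HankelFrameChange Summit.Ventures.HSemireg.Wedge.Weil
  Summit.Ventures.HSemireg.Wedge.HankelPairMixing Summit.Ventures.HSemireg.Wedge.HankelPairGrading

variable (K : Type*) [Field K] {N : ℕ}

/-! ## §380. Every pair type is `𝟙_{A₁} + 2·𝟙_{A₂}` -/

omit [Field K] in
/-- a pair has two letters: `ptype s c ≤ 2`. -/
theorem ptype_le_two (s : Finset (In N)) (c : Fin N) : ptype s c ≤ 2 := by
  by_cases h : xJ N c ∈ s ∧ yJ N c ∈ s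
  · exact le_of_eq (ptype_eq_two_of_pair_subset h.1 h.2)
  · exact le_trans (ptype_le_one_of_not_pair_subset h) one_le_two

omit [Field K] in
/-- **every pair type is `[· ∈ A₁] + 2 [· ∈ A₂]`** with `A₁ = {c : ptype s c = 1}` and `A₂ = {c : ptype s c = 2}`. -/
theorem ptype_eq_one_two (s : Finset (In N)) :
    ptype s = fun c => if c ∈ Finset.univ.filter (fun c => ptype s c = 1) then 1 else if c ∈ Finset.univ.filter (fun c => ptype s c = 2) then 2 else 0 := by
  funext c
  simp only [Finset.mem_filter, Finset.mem_univ, true_and]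
  have h := ptype_le_two s c
  by_cases h1 : ptype s c = 1
  · rw [if_pos h1, h1]
  · rw [if_neg h1]
    by_cases h2 : ptype s c = 2
    · rw [if_pos h2, h2]
    · rw [if_neg h2]
      omega

omit [Field K] in
/-- the two index sets of a pair type are disjoint. -/
theorem disjoint_filter_ptype_one_two (s : Finset (In N)) :
    Disjoint (Finset.univ.filter fun c => ptype s c = 1) (Finset.univ.filter fun c => ptype s c = 2) := by
  rw [Finset.disjoint_filter]
  intro c _ h1 h2
  omega

/-! ## §381. The count `2^{|A₁|}` -/

omit [Field K] in
/-- **the letters of `A₂` have pair type `2·𝟙_{A₂}`.** -/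
theorem ptype_letters (A₂ : Finset (Fin N)) : ptype (Finset.univ.filter fun i : In N => pr i ∈ A₂) = fun c => if c ∈ A₂ then 2 else 0 := by
  rw [letters_eq_image_union_image, ptype_union (disjoint_image_xJ_image_yJ A₂ A₂), ptype_image_xJ, ptype_image_yJ]
  funext c
  simp only [Pi.add_apply]
  split_ifs <;> rfl

omit [Field K] in
/-- a support of type `𝟙_{A₁} + 2·𝟙_{A₂}` contains all letters of `A₂`. -/
theorem letters_subset_of_ptype_eq_one_two {A₁ A₂ : Finset (Fin N)} {s : Finset (In N)}
    (hs : ptype s = fun c => if c ∈ A₁ then 1 else if c ∈ A₂ then 2 else 0) (hd : Disjoint A₁ A₂) :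
    (Finset.univ.filter fun i : In N => pr i ∈ A₂) ⊆ s := by
  intro i hi
  rw [Finset.mem_filter] at hi
  have h2 : 2 ≤ ptype s (pr i) := by
    rw [hs]
    dsimp only
    rw [if_neg (fun h1 => Finset.disjoint_left.mp hd h1 hi.2), if_pos hi.2]
  obtain ⟨hx, hy⟩ := pair_subset_of_two_le_ptype h2
  rcases eq_xJ_or_eq_yJ i with e | e
  · exact e ▸ hx
  · exact e ▸ hy

omit [Field K] in
/-- removing the letters of `A₂` from a support of type `𝟙_{A₁} + 2·𝟙_{A₂}` leaves a pure support on `A₁`. -/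
theorem ptype_sdiff_letters_eq_indicator {A₁ A₂ : Finset (Fin N)} {s : Finset (In N)}
    (hs : ptype s = fun c => if c ∈ A₁ then 1 else if c ∈ A₂ then 2 else 0) (hd : Disjoint A₁ A₂) :
    ptype (s \ Finset.univ.filter fun i : In N => pr i ∈ A₂) = fun c => if c ∈ A₁ then 1 else 0 := by
  have hsub := letters_subset_of_ptype_eq_one_two hs hd
  have hu : s \ (Finset.univ.filter fun i : In N => pr i ∈ A₂) ∪ (Finset.univ.filter fun i : In N => pr i ∈ A₂) = s := Finset.sdiff_union_of_subset hsub
  have h := ptype_union (N := N) (Finset.sdiff_disjoint : Disjoint (s \ Finset.univ.filter fun i : In N => pr i ∈ A₂) (Finset.univ.filter fun i : In N => pr i ∈ A₂))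
  rw [hu, hs, ptype_letters] at h
  funext c
  have hc := congr_fun h c
  simp only [Pi.add_apply] at hc
  by_cases h1 : c ∈ A₁
  · have h2 : c ∉ A₂ := fun h2 => Finset.disjoint_left.mp hd h1 h2
    simp only [h1, h2, if_true, if_false] at hc ⊢
    omega
  · by_cases h2 : c ∈ A₂
    · simp only [h1, h2, if_true, if_false] at hc ⊢
      omega
    · simp only [h1, h2, if_false] at hc ⊢
      omega

omit [Field K] in
/-- conversely a pure support on `A₁` together with the letters of `A₂` has type `𝟙_{A₁} + 2·𝟙_{A₂}`. -/
theorem ptype_union_letters_eq_one_two {A₁ A₂ : Finset (Fin N)} {s' : Finset (In N)} (hs' : ptype s' = fun c => if c ∈ A₁ then 1 else 0) (hd : Disjoint A₁ A₂) :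
    ptype (s' ∪ Finset.univ.filter fun i : In N => pr i ∈ A₂) = fun c => if c ∈ A₁ then 1 else if c ∈ A₂ then 2 else 0 := by
  have hdis : Disjoint s' (Finset.univ.filter fun i : In N => pr i ∈ A₂) := by
    rw [Finset.disjoint_left]
    intro i hi hi2
    rw [Finset.mem_filter] at hi2
    exact Finset.disjoint_left.mp hd (mem_pairs_of_ptype_eq_indicator hs' i hi) hi2.2
  rw [ptype_union hdis, hs', ptype_letters]
  funext c
  simp only [Pi.add_apply]
  by_cases h1 : c ∈ A₁
  · rw [if_pos h1, if_pos h1, if_neg (fun h2 => Finset.disjoint_left.mp hd h1 h2)]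
  · rw [if_neg h1, if_neg h1]
    split_ifs <;> rfl

omit [Field K] in
/-- **THE COUNT: `#{s : ptype s = 𝟙_{A₁} + 2·𝟙_{A₂}} = 2^{|A₁|}`** for disjoint `A₁`, `A₂` (`s ↦ s ∖ letters(A₂)` is a bijection onto the pure supports on `A₁`, L2). -/
theorem card_filter_ptype_eq_one_two {A₁ A₂ : Finset (Fin N)} (hd : Disjoint A₁ A₂) :
    (Finset.univ.filter fun s : Finset (In N) => ptype s = fun c => if c ∈ A₁ then 1 else if c ∈ A₂ then 2 else 0).card = 2 ^ A₁.card := by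
  classical
  rw [← card_filter_ptype_eq_indicator A₁]
  have himage : (Finset.univ.filter fun s : Finset (In N) => ptype s = fun c => if c ∈ A₁ then 1 else if c ∈ A₂ then 2 else 0)
      = (Finset.univ.filter fun s' : Finset (In N) => ptype s' = fun c => if c ∈ A₁ then 1 else 0).image
          fun s' => s' ∪ Finset.univ.filter fun i : In N => pr i ∈ A₂ := by
    ext s
    simp only [Finset.mem_filter, Finset.mem_univ, true_and, Finset.mem_image]
    constructor
    · intro hs
      exact ⟨s \ Finset.univ.filter (fun i : In N => pr i ∈ A₂), ptype_sdiff_letters_eq_indicator hs hd,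
        Finset.sdiff_union_of_subset (letters_subset_of_ptype_eq_one_two hs hd)⟩
    · rintro ⟨s', hs', rfl⟩
      exact ptype_union_letters_eq_one_two hs' hd
  rw [himage, Finset.card_image_of_injOn]
  intro s' hs' t' ht' h
  rw [Finset.coe_filter, Set.mem_setOf_eq] at hs' ht'
  have hdis : ∀ {u : Finset (In N)}, (ptype u = fun c => if c ∈ A₁ then 1 else 0) → Disjoint u (Finset.univ.filter fun i : In N => pr i ∈ A₂) := by
    intro u hu
    rw [Finset.disjoint_left]
    intro i hi hi2
    rw [Finset.mem_filter] at hi2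
    exact Finset.disjoint_left.mp hd (mem_pairs_of_ptype_eq_indicator hu i hi) hi2.2
  have e1 := Finset.union_sdiff_cancel_right (hdis hs'.2)
  have e2 := Finset.union_sdiff_cancel_right (hdis ht'.2)
  rw [← e1, ← e2]
  exact congr_arg (fun u : Finset (In N) => u \ Finset.univ.filter fun i : In N => pr i ∈ A₂) h

/-- **`dim Sp(ptype = 𝟙_{A₁} + 2·𝟙_{A₂}) = 2^{|A₁|}`** (`A₁ ∩ A₂ = ∅`). -/
theorem finrank_Sp_ptype_one_two {A₁ A₂ : Finset (Fin N)} (hd : Disjoint A₁ A₂) :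
    finrank K ↥(Sp K (fun s : Finset (In N) => ptype s = fun c => if c ∈ A₁ then 1 else if c ∈ A₂ then 2 else 0)) = 2 ^ A₁.card := by
  classical
  rw [finrank_Sp, card_filter_ptype_eq_one_two hd]

omit [Field K] in
/-- a support of type `𝟙_{A₁} + 2·𝟙_{A₂}` has `|A₁| + 2|A₂|` letters. -/
theorem card_eq_of_ptype_eq_one_two {A₁ A₂ : Finset (Fin N)} {s : Finset (In N)}
    (hs : ptype s = fun c => if c ∈ A₁ then 1 else if c ∈ A₂ then 2 else 0) (hd : Disjoint A₁ A₂) : s.card = A₁.card + (A₂.card + A₂.card) := by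
  have hsub := letters_subset_of_ptype_eq_one_two hs hd
  rw [← Finset.sdiff_union_of_subset hsub, Finset.card_union_of_disjoint Finset.sdiff_disjoint, card_letters_eq,
    card_eq_of_ptype_eq_indicator (ptype_sdiff_letters_eq_indicator hs hd)]

/-- the piece of type `𝟙_{A₁} + 2·𝟙_{A₂}` lives in degree `|A₁| + 2|A₂|`: `Hom(univ, |A₁|+2|A₂|) ⊓ Sp(ptype = τ) = Sp(ptype = τ)`. -/
theorem Hom_inf_Sp_ptype_one_two {A₁ A₂ : Finset (Fin N)} (hd : Disjoint A₁ A₂) :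
    Hom K (In N) (Finset.univ : Finset (In N)) (A₁.card + (A₂.card + A₂.card))
        ⊓ Sp K (fun s : Finset (In N) => ptype s = fun c => if c ∈ A₁ then 1 else if c ∈ A₂ then 2 else 0)
      = Sp K (fun s : Finset (In N) => ptype s = fun c => if c ∈ A₁ then 1 else if c ∈ A₂ then 2 else 0) := by
  rw [Hom_eq_Sp]
  exact inf_eq_right.mpr (Sp_mono fun s hs => ⟨Finset.subset_univ _, card_eq_of_ptype_eq_one_two hs hd⟩)

/-! ## §382. The complete table of pieces for th-7's class -/

/-- **`A₂ ≠ ∅`: THE WHOLE PIECE IS KERNEL, `dim (Kr(univ, w_N q, |A₁|+2|A₂|) ⊓ Sp(ptype = 𝟙_{A₁} + 2·𝟙_{A₂})) = 2^{|A₁|}`.** -/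
theorem finrank_Kr_w_inf_Sp_ptype_one_two_of_nonempty {A₁ A₂ : Finset (Fin N)} (hd : Disjoint A₁ A₂) (hne : A₂.Nonempty) (q : ℕ → K) :
    finrank K ↥(Kr K (Finset.univ : Finset (In N)) (w K N N q) (A₁.card + (A₂.card + A₂.card))
        ⊓ Sp K (fun s : Finset (In N) => ptype s = fun c => if c ∈ A₁ then 1 else if c ∈ A₂ then 2 else 0)) = 2 ^ A₁.card := by
  obtain ⟨c, hc⟩ := hne
  have h2 : 2 ≤ (fun c : Fin N => if c ∈ A₁ then 1 else if c ∈ A₂ then 2 else 0) c := by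
    dsimp only
    rw [if_neg (fun h1 => Finset.disjoint_left.mp hd h1 hc), if_pos hc]
  rw [Kr_inf_Sp_ptype_eq_Hom_inf_of_two_le K h2 (w_mem_Sp_Tr K q), Hom_inf_Sp_ptype_one_two K hd, finrank_Sp_ptype_one_two K hd]

/-- **`A₂ ≠ ∅`: NO IMAGE, `dim (V(univ, w_N q, |A₁|+2|A₂|) ⊓ Sp(ptype = 𝟙_{A₁} + 2·𝟙_{A₂} + 𝟙)) = 0`.** -/
theorem finrank_V_w_inf_Sp_ptype_one_two_succ_of_nonempty {A₁ A₂ : Finset (Fin N)} (hd : Disjoint A₁ A₂) (hne : A₂.Nonempty) (q : ℕ → K) :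
    finrank K ↥(V K (In N) (Finset.univ : Finset (In N)) (w K N N q) (A₁.card + (A₂.card + A₂.card))
        ⊓ Sp K (fun s : Finset (In N) => ptype s = (fun c => if c ∈ A₁ then 1 else if c ∈ A₂ then 2 else 0) + 1)) = 0 := by
  obtain ⟨c, hc⟩ := hne
  have h2 : 2 ≤ (fun c : Fin N => if c ∈ A₁ then 1 else if c ∈ A₂ then 2 else 0) c := by
    dsimp only
    rw [if_neg (fun h1 => Finset.disjoint_left.mp hd h1 hc), if_pos hc]
  exact finrank_V_inf_Sp_ptype_succ_eq_zero_of_two_le K h2 (w_mem_Sp_Tr K q) _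

/-- **THE KERNEL TABLE: `dim (Kr(univ, w_N q, k) ⊓ Sp(ptype = 𝟙_{A₁} + 2·𝟙_{A₂})) + [A₂ = ∅] · rank (hankel1 K N k q) = 2^{|A₁|}`**, `k = |A₁| + 2|A₂|`, for all disjoint
`A₁`, `A₂`, every `q`, every field. -/
theorem finrank_Kr_w_inf_Sp_ptype_one_two_add {A₁ A₂ : Finset (Fin N)} (hd : Disjoint A₁ A₂) (q : ℕ → K) :
    finrank K ↥(Kr K (Finset.univ : Finset (In N)) (w K N N q) (A₁.card + (A₂.card + A₂.card))
        ⊓ Sp K (fun s : Finset (In N) => ptype s = fun c => if c ∈ A₁ then 1 else if c ∈ A₂ then 2 else 0))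
      + (if A₂ = ∅ then 1 else 0) * (hankel1 K N (A₁.card + (A₂.card + A₂.card)) q).rank = 2 ^ A₁.card := by
  by_cases hA : A₂ = ∅
  · subst hA
    rw [if_pos rfl, one_mul]
    have hSp : Sp K (fun s : Finset (In N) => ptype s = fun c => if c ∈ A₁ then 1 else if c ∈ (∅ : Finset (Fin N)) then 2 else 0)
        = Sp K (fun s : Finset (In N) => ptype s = fun c => if c ∈ A₁ then 1 else 0) :=
      Sp_congr_iff K fun s => by simp only [Finset.notMem_empty, if_false]
    rw [hSp, Finset.card_empty, add_zero, add_zero]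
    exact finrank_Kr_w_inf_Sp_pure_add K A₁ q
  · rw [if_neg hA, zero_mul, add_zero]
    exact finrank_Kr_w_inf_Sp_ptype_one_two_of_nonempty K hd (Finset.nonempty_iff_ne_empty.mpr hA) q

/-- **THE IMAGE TABLE: `dim (V(univ, w_N q, k) ⊓ Sp(ptype = 𝟙_{A₁} + 2·𝟙_{A₂} + 𝟙)) = [A₂ = ∅] · rank (hankel1 K N k q)`**, `k = |A₁| + 2|A₂|`, for all disjoint `A₁`, `A₂`,
every `q`, every field. -/
theorem finrank_V_w_inf_Sp_ptype_one_two_succ {A₁ A₂ : Finset (Fin N)} (hd : Disjoint A₁ A₂) (q : ℕ → K) :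
    finrank K ↥(V K (In N) (Finset.univ : Finset (In N)) (w K N N q) (A₁.card + (A₂.card + A₂.card))
        ⊓ Sp K (fun s : Finset (In N) => ptype s = (fun c => if c ∈ A₁ then 1 else if c ∈ A₂ then 2 else 0) + 1))
      = (if A₂ = ∅ then 1 else 0) * (hankel1 K N (A₁.card + (A₂.card + A₂.card)) q).rank := by
  by_cases hA : A₂ = ∅
  · subst hA
    rw [if_pos rfl, one_mul]
    have hSp : Sp K (fun s : Finset (In N) => ptype s = (fun c => if c ∈ A₁ then 1 else if c ∈ (∅ : Finset (Fin N)) then 2 else 0) + 1)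
        = Sp K (fun s : Finset (In N) => ptype s = (fun c => if c ∈ A₁ then 1 else 0) + 1) :=
      Sp_congr_iff K fun s => by simp only [Finset.notMem_empty, if_false]
    rw [hSp, Finset.card_empty, add_zero, add_zero]
    exact finrank_V_w_inf_Sp_pure_succ K A₁ q
  · rw [if_neg hA, zero_mul]
    exact finrank_V_w_inf_Sp_ptype_one_two_succ_of_nonempty K hd (Finset.nonempty_iff_ne_empty.mpr hA) q

end Summit.Ventures.HSemireg.Wedge.HankelOuter
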